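import Summits.CriticalPhenomena.PercolationContinuityZ3.Theorems.Transplant.SkelFrmBParamsSlotsT
import Summits.CriticalPhenomena.PercolationContinuityZ3.Theorems.Transplant.SkelNegBParamsSlotsT
import Summits.CriticalPhenomena.PercolationContinuityZ3.Theorems.Transplant.SkelPhiFaceRunN
import Summits.CriticalPhenomena.PercolationContinuityZ3.Theorems.Transplant.SkelFrm1SlotTypes
import Summits.CriticalPhenomena.PercolationContinuityZ3.Theorems.Transplant.SkelFrm1ParamsPO
import Summits.CriticalPhenomena.PercolationContinuityZ3.Theorems.Transplant.SkelFrm1ParamsLBL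
import Summits.CriticalPhenomena.PercolationContinuityZ3.Theorems.Transplant.SkelFrmBParamsKitA
import Summits.CriticalPhenomena.PercolationContinuityZ3.Theorems.Transplant.SkelFrmBParamsKitS
import Summits.CriticalPhenomena.PercolationContinuityZ3.Theorems.Transplant.SkelFrm1ParamsLF
import Summits.CriticalPhenomena.PercolationContinuityZ3.Theorems.Transplant.SkelFrm1ParamsLO
import Summits.CriticalPhenomena.PercolationContinuityZ3.Theorems.Transplant.SkelFrmBParamsLF
import Summits.CriticalPhenomena.PercolationContinuityZ3.Theorems.Transplant.SkelFrmBParamsFineSize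
import Summits.CriticalPhenomena.PercolationContinuityZ3.Theorems.Transplant.SkelFrmBParamsLO
import Summits.CriticalPhenomena.PercolationContinuityZ3.Theorems.Transplant.SkelFrmBParamsB
import Summits.CriticalPhenomena.PercolationContinuityZ3.Theorems.Transplant.SkelFrmBParamsSlotsR
import Summits.CriticalPhenomena.PercolationContinuityZ3.Theorems.Transplant.SkelFrmBParamsSlotsRS
import Summits.CriticalPhenomena.PercolationContinuityZ3.Theorems.Transplant.SkelFrmBParamsSlots
import Summits.CriticalPhenomena.PercolationContinuityZ3.Theorems.Transplant.SkelFrmBParamsSched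
import Summits.CriticalPhenomena.PercolationContinuityZ3.Theorems.Transplant.SkelFrmBParamsReachFC
import Summits.CriticalPhenomena.PercolationContinuityZ3.Theorems.Transplant.SkelNegBParamsFaceLat
import Summits.CriticalPhenomena.PercolationContinuityZ3.Theorems.Transplant.PlanarSkeletonFrmDefs
import Summits.CriticalPhenomena.PercolationContinuityZ3.Theorems.Transplant.SkelPhiStepIDataNS
import HarnessLib

/-!
# N2 (frames-only node `SamePDropOfSkeletonFrm₁`, OPEN) params column over `PlanarSkeletonFrm` — (ζ″) ledger, shape (B′) of record ((R-14)):
# MECHANICAL PORT of N1's `SkelNegBParamsFaceLat` — chain of record `NegB`, part FaceLat: THE LATTICE BOUNDS OF THE FRAME RECORD `prF` that size hp-8's face-step slots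
# (`k₀F/awF/kFF/mF`, `SkelPhiFaceSlots` p299147) — **`cL_lower`** (`11·D < 13·(c_I·L_I)` from `D < (m_I+1)·(20K·800·L̂_I)`, `c_I = 20K·s_I`, `s_I = m_I − 1 ≥ 11`),
# `cL_upper` (`c_I·L_I … (N1 title abridged; see `SkelNegBParamsFaceLat`)
builds on p205010 (kernel theorem, internal audit signed; external expert review pending) — nothing in this file uses p205010; NOTHING is claimed about the
open node `SamePDropOfSkeletonFrm₁` (`SamePDropOfSkeletonNeg₁` is CLOSED in the tree and untouched by this file).
Status sentence (coordinator 2026-08-20T04:30Z): "θ(p_c) = 0 on ℤ^d, all d ≥ 2 — kernel-verified (Lean 4/Mathlib, standard axioms); internal adversarial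
audit SIGNED 2026-08-20 04:29Z; external expert review pending."
Lane `prim-bschramm-*`, seat `prim-bschramm-p1` (gen 17; (F) value-layer leaf, lead g11 06:35:07Z) running stmt-g19's port tool of record; helper file (`--supports stmt-CriticalPhenomena-4575 --as helper`); ledger HOME/prim-bschramm-stmt/FRM-PARAMS.md §9, (R-14).
PORT RULES (HOME/prim-bschramm-stmt-g19/lean/port_frm.py, the tool of record per (R-14)): outer namespace `PlanarSkeletonNeg ↦ PlanarSkeletonFrm`, carrier binder
`(Φ : PlanarSkeletonFrm G)`, record binder `(D : Skelφ.StepI.DataNS V)` (the selectors travel IN the record, `SkelPhiStepIDataNS`); section variables INLINED into every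
declaration header; inner namespaces (`Neg`/`NegB`/`KS`/…) and every short name KEPT so all cross-references resolve unchanged; declarations using no section variable are
NOT re-declared (N1's originals are referenced fully qualified). Mathematical content, proofs, docstrings and citations are N1's, verbatim, except where stated next.
SELECTORS IN THIS FILE ((R-14) condition of record — joint selection, `D.sN`'s first argument is the literal handed to `D.sM`): none (pure port; the pairs are read through their N1 names).
N1 HEADER (kept for the reader):
helper file (`--supports stmt-CriticalPhenomena-4575 --as helper`); ledger HOME/prim-bschramm-stmt/NEG-PARAMS.md v0.13.
* §1 `L_eq` (`prF.L 0 = 800·L̂₀`, `prF.L 1 = 800·L̂₁`), `cL_upper`, **`cL_lower`**, `rdK_lower`, `rdN_upper`, `Mabs_eq`; §2 `rdK_pos_R`, `k₀_ceil_le_three`, `rdN_le_three_rdK`,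
  `eleven_le_s_T`, **`hk₀'_R`**.
[cite: KozmaNitzan2024, §4 Lemma 10 Step IV; Lemma 12 (pp. 23–25)] [cite: MartineauTassion2017, §4.3]
-/

noncomputable section

open scoped Classical

namespace Summit.CriticalPhenomena.PercolationContinuityZ3.Theorems.Transplant

namespace PlanarSkeletonFrm

namespace NegB

open Literature.Probability.Percolation Literature.Probability.LatticeModels SimpleGraph
open SkelConc (Consts)
open Skelφ.StepI (DataN)
open TwoAxis.Para (modulus)
open Literature.Probability.Percolation.KozmaNitzan.Cells (oth)
open Neg

section Lat

/-! ## §1 The lattice bounds -/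

/-- `prF.L 0 = 800·L̂₀` and `prF.L 1 = 800·L̂₁` (under `1 ≤ n_L`). [folklore] -/
theorem L_eq (κ : Consts) {V : Type} [DecidableEq V] [Countable V] {G : SimpleGraph V} [G.LocallyFinite] (Φ : PlanarSkeletonFrm G) (t : V) (p : unitInterval) (D : Skelφ.StepI.DataNS V) (g : ℕ) (f : ℕ) :
    (prF κ Φ t p D g f).L 0 = 800 * Skelφ.NegPrm.L0hat (nL κ Φ t p D g f) (hL κ Φ t p D g f) (ℓL κ Φ t p D g f) (vL κ Φ t p D g f) ∧
      (prF κ Φ t p D g f).L 1 = 800 * Skelφ.NegPrm.L1hat (nL κ Φ t p D g f) (hL κ Φ t p D g f) := by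
  obtain ⟨hA, hn, hh, hvα, hvβ, -, -, -⟩ := prF_fields κ Φ t p D g f
  have hn0 : (0 : ℤ) ≤ (nL κ Φ t p D g f : ℤ) := by positivity
  unfold Skelφ.FinePrm.L Skelφ.NegPrm.L0hat Skelφ.NegPrm.L1hat
  simp only [Skelφ.FinePrm.lvGen_zero_zero, Skelφ.FinePrm.lvGen_zero_one, Skelφ.FinePrm.lvGen_one_zero, Skelφ.FinePrm.lvGen_one_one, hA, hn, hh, hvα, hvβ]
  refine ⟨by unfold vβL; simp only [abs_of_nonneg (show (0:ℤ) ≤ 800 by norm_num)]; ring, ?_⟩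
  rw [abs_of_nonneg (show (0:ℤ) ≤ 800 by norm_num), abs_of_nonneg hn0]

/-- **Upper**: `c_I·L_I + 2 ≤ D` (`prF_room`). [folklore] -/
theorem cL_upper (κ : Consts) {V : Type} [DecidableEq V] [Countable V] {G : SimpleGraph V} [G.LocallyFinite] (Φ : PlanarSkeletonFrm G) (t : V) (p : unitInterval) (D : Skelφ.StepI.DataNS V) (g : ℕ) (f : ℕ) (hN : EqNumL κ Φ t p D g f) (I : Fin 2) : (prF κ Φ t p D g f).cOf I * (prF κ Φ t p D g f).L I + 2 ≤ (prF κ Φ t p D g f).D := by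
  obtain ⟨h0, h1⟩ := prF_room κ Φ t p D g f hN
  obtain rfl | rfl : I = 0 ∨ I = 1 := by fin_cases I <;> simp
  · rwa [Skelφ.FinePrm.cOf_zero]
  · rwa [Skelφ.FinePrm.cOf_one]

/-- **Lower**: `11·D < 13·(c_I·L_I)` whenever `11 ≤ s_I` (from `D < (m_I+1)·20K·800·L̂_I`, `c_I·L_I = 20K·s_I·800·L̂_I`, `s_I = m_I − 1`). [folklore] -/
theorem cL_lower (κ : Consts) {V : Type} [DecidableEq V] [Countable V] {G : SimpleGraph V} [G.LocallyFinite] (Φ : PlanarSkeletonFrm G) (t : V) (p : unitInterval) (D : Skelφ.StepI.DataNS V) (g : ℕ) (f : ℕ) (hN : EqNumL κ Φ t p D g f) (I : Fin 2) (hs : 11 ≤ (fcells κ Φ t p D g f).s I) :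
    11 * (prF κ Φ t p D g f).D < 13 * ((prF κ Φ t p D g f).cOf I * (prF κ Φ t p D g f).L I) := by
  obtain ⟨hL0, hL1⟩ := L_eq κ Φ t p D g f
  obtain ⟨-, -, -, -, -, hc0, hc1, hD⟩ := prF_fields κ Φ t p D g f
  obtain ⟨hs0, hs1⟩ := fcells_s_at κ Φ t p D g f hN
  obtain ⟨hlt0, hlt1⟩ := mOf_floor_lt κ Φ t p D g f hN
  have hK := (fcells_K κ Φ t p D g f).1
  have hL0nn := Skelφ.NegPrm.Lhat_nonneg (nL κ Φ t p D g f) (hL κ Φ t p D g f) (ℓL κ Φ t p D g f) (vL κ Φ t p D g f)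
  have hK40 : (40 : ℤ) ≤ Neg.K κ := by exact_mod_cast (Neg.forty_le_K κ).1
  obtain rfl | rfl : I = 0 ∨ I = 1 := by fin_cases I <;> simp
  · rw [Skelφ.FinePrm.cOf_zero, hc0, hL0, hD, hK]
    have hs' : (11 : ℤ) ≤ (((fcells κ Φ t p D g f).s 0 : ℕ) : ℤ) := by exact_mod_cast hs
    have e : m0 κ Φ t p D g f = (((fcells κ Φ t p D g f).s 0 : ℕ) : ℤ) + 1 := by rw [hs0]; unfold fm0; ring
    rw [e] at hlt0
    set u : ℤ := 20 * (Neg.K κ : ℤ) * (800 * Skelφ.NegPrm.L0hat (nL κ Φ t p D g f) (hL κ Φ t p D g f) (ℓL κ Φ t p D g f) (vL κ Φ t p D g f)) with hu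
    have hu0 : 0 ≤ u := by rw [hu]; have := hL0nn.1; positivity
    have h13 : 11 * ((((fcells κ Φ t p D g f).s 0 : ℕ) : ℤ) + 1 + 1) ≤ 13 * (((fcells κ Φ t p D g f).s 0 : ℕ) : ℤ) := by linarith
    have h1 : 11 * Skelφ.NegPrm.Dof (nL κ Φ t p D g f) (hL κ Φ t p D g f) (ℓL κ Φ t p D g f) (vL κ Φ t p D g f) <
        11 * (((((fcells κ Φ t p D g f).s 0 : ℕ) : ℤ) + 1 + 1) * u) := by linarith
    have h2 : 11 * (((((fcells κ Φ t p D g f).s 0 : ℕ) : ℤ) + 1 + 1) * u) ≤ 13 * ((((fcells κ Φ t p D g f).s 0 : ℕ) : ℤ) * u) := by nlinarith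
    have e2 : 20 * (Neg.K κ : ℤ) * (((fcells κ Φ t p D g f).s 0 : ℕ) : ℤ) * (800 * Skelφ.NegPrm.L0hat (nL κ Φ t p D g f) (hL κ Φ t p D g f) (ℓL κ Φ t p D g f) (vL κ Φ t p D g f)) =
        (((fcells κ Φ t p D g f).s 0 : ℕ) : ℤ) * u := by rw [hu]; ring
    rw [e2]; linarith
  · rw [Skelφ.FinePrm.cOf_one, hc1, hL1, hD, hK]
    have hs' : (11 : ℤ) ≤ (((fcells κ Φ t p D g f).s 1 : ℕ) : ℤ) := by exact_mod_cast hs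
    have e : m1 κ Φ t p D g f = (((fcells κ Φ t p D g f).s 1 : ℕ) : ℤ) + 1 := by rw [hs1]; unfold fm1; ring
    rw [e] at hlt1
    set u : ℤ := 20 * (Neg.K κ : ℤ) * (800 * Skelφ.NegPrm.L1hat (nL κ Φ t p D g f) (hL κ Φ t p D g f)) with hu
    have hu0 : 0 ≤ u := by rw [hu]; have := hL0nn.2; positivity
    have h1 : 11 * Skelφ.NegPrm.Dof (nL κ Φ t p D g f) (hL κ Φ t p D g f) (ℓL κ Φ t p D g f) (vL κ Φ t p D g f) <
        11 * (((((fcells κ Φ t p D g f).s 1 : ℕ) : ℤ) + 1 + 1) * u) := by linarith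
    have h2 : 11 * (((((fcells κ Φ t p D g f).s 1 : ℕ) : ℤ) + 1 + 1) * u) ≤ 13 * ((((fcells κ Φ t p D g f).s 1 : ℕ) : ℤ) * u) := by nlinarith
    have e2 : 20 * (Neg.K κ : ℤ) * (((fcells κ Φ t p D g f).s 1 : ℕ) : ℤ) * (800 * Skelφ.NegPrm.L1hat (nL κ Φ t p D g f) (hL κ Φ t p D g f)) =
        (((fcells κ Φ t p D g f).s 1 : ℕ) : ℤ) * u := by rw [hu]; ring
    rw [e2]; linarith

/-- **The raw axis carries half the generator**: `c_I·L_I ≤ 1600·rdK I (bOf I)` (`L_I = 800·(|lv 0|+|lv 1|)`, `|lv (bOf I)| ≥ |lv (oth (bOf I))|`). [folklore] -/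
theorem rdK_lower (κ : Consts) {V : Type} [DecidableEq V] [Countable V] {G : SimpleGraph V} [G.LocallyFinite] (Φ : PlanarSkeletonFrm G) (t : V) (p : unitInterval) (D : Skelφ.StepI.DataNS V) (g : ℕ) (f : ℕ) (I : Fin 2) : (prF κ Φ t p D g f).cOf I * (prF κ Φ t p D g f).L I ≤ 1600 * (prF κ Φ t p D g f).rdK I ((prF κ Φ t p D g f).bOf I) := by
  set pr := prF κ Φ t p D g f
  have hA : pr.A = 800 := (prF_fields κ Φ t p D g f).1
  have hb := pr.abs_lvGen_oth_bOf_le I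
  have hc : 0 ≤ pr.cOf I := (pr.cOf_pos (prF_c_pos κ Φ t p D g f).1 (prF_c_pos κ Φ t p D g f).2 I).le
  unfold Skelφ.FinePrm.rdK Skelφ.FinePrm.L
  rw [hA, abs_of_nonneg (show (0:ℤ) ≤ 800 by norm_num)]
  have hsum : |pr.lvGen I 0| + |pr.lvGen I 1| ≤ 2 * |pr.lvGen I (pr.bOf I)| := by
    have : pr.bOf I = 0 ∨ pr.bOf I = 1 := by
      generalize pr.bOf I = b; fin_cases b <;> simp
    rcases this with h0 | h1
    · rw [h0] at hb ⊢; have : oth (0 : Fin 2) = 1 := rfl; rw [this] at hb; linarith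
    · rw [h1] at hb ⊢; have : oth (1 : Fin 2) = 0 := rfl; rw [this] at hb; linarith
  nlinarith

/-- **The other generator is at most `D/800`**: `800·rdN I b ≤ D` for every `b` (`rdN I b = c_J·|lv_J b| ≤ c_J·L_J/800 ≤ D/800`). [folklore] -/
theorem rdN_upper (κ : Consts) {V : Type} [DecidableEq V] [Countable V] {G : SimpleGraph V} [G.LocallyFinite] (Φ : PlanarSkeletonFrm G) (t : V) (p : unitInterval) (D : Skelφ.StepI.DataNS V) (g : ℕ) (f : ℕ) (hN : EqNumL κ Φ t p D g f) (I b : Fin 2) : 800 * (prF κ Φ t p D g f).rdN I b ≤ (prF κ Φ t p D g f).D := by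
  set pr := prF κ Φ t p D g f
  have hA : pr.A = 800 := (prF_fields κ Φ t p D g f).1
  have hJ := cL_upper κ Φ t p D g f hN (oth I)
  have hc : 0 ≤ pr.cOf (oth I) := (pr.cOf_pos (prF_c_pos κ Φ t p D g f).1 (prF_c_pos κ Φ t p D g f).2 (oth I)).le
  have hle : |pr.lvGen (oth I) b| ≤ |pr.lvGen (oth I) 0| + |pr.lvGen (oth I) 1| := by
    obtain rfl | rfl : b = 0 ∨ b = 1 := by fin_cases b <;> simp
    · linarith [abs_nonneg (pr.lvGen (oth I) 1)]
    · linarith [abs_nonneg (pr.lvGen (oth I) 0)]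
  have hL : pr.L (oth I) = 800 * (|pr.lvGen (oth I) 0| + |pr.lvGen (oth I) 1|) := by
    unfold Skelφ.FinePrm.L; rw [hA, abs_of_nonneg (show (0:ℤ) ≤ 800 by norm_num)]
  unfold Skelφ.FinePrm.rdN
  rw [hL] at hJ
  nlinarith

/-- **`800·Mabs = c₀·c₁·D`** (`D = 800²·modulus`, `modulus > 0`). [folklore] -/
theorem Mabs_eq (κ : Consts) {V : Type} [DecidableEq V] [Countable V] {G : SimpleGraph V} [G.LocallyFinite] (Φ : PlanarSkeletonFrm G) (t : V) (p : unitInterval) (D : Skelφ.StepI.DataNS V) (g : ℕ) (f : ℕ) (hN : EqNumL κ Φ t p D g f) : 800 * (prF κ Φ t p D g f).Mabs = (prF κ Φ t p D g f).c₀ * (prF κ Φ t p D g f).c₁ * (prF κ Φ t p D g f).D := by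
  set pr := prF κ Φ t p D g f
  have hA : pr.A = 800 := (prF_fields κ Φ t p D g f).1
  have hm := (prF_pos κ Φ t p D g f hN).2.2.1
  have hDd : pr.D = TwoAxis.Para.detD pr.A pr.n pr.h pr.vα pr.vβ := prF_D κ Φ t p D g f
  unfold Skelφ.FinePrm.Mabs
  rw [hDd]; unfold TwoAxis.Para.detD; rw [hA, abs_of_pos (by positivity)]
  ring

/-! ## §2 The first consequence: the `k₀` ceiling is at most `3`, and `hk₀'` -/

/-- `0 < rdK I (bOf I)` at the frame record (twin of hp-8's `FinePrm.rdK_pos`, stated here to keep this file independent of `SkelPhiFaceSlots`). [folklore] -/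
theorem rdK_pos_R (κ : Consts) {V : Type} [DecidableEq V] [Countable V] {G : SimpleGraph V} [G.LocallyFinite] (Φ : PlanarSkeletonFrm G) (t : V) (p : unitInterval) (D : Skelφ.StepI.DataNS V) (g : ℕ) (f : ℕ) (hN : EqNumL κ Φ t p D g f) (I : Fin 2) : 0 < (prF κ Φ t p D g f).rdK I ((prF κ Φ t p D g f).bOf I) := by
  set pr := prF κ Φ t p D g f
  unfold Skelφ.FinePrm.rdK
  exact mul_pos (pr.cOf_pos (prF_c_pos κ Φ t p D g f).1 (prF_c_pos κ Φ t p D g f).2 I)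
    (abs_pos.2 (pr.lvGen_bOf_ne_zero I (pr.lvGen_ne_zero_of_detD_pos (prF_D κ Φ t p D g f) (prF_pos κ Φ t p D g f hN).2.2.2.2.2 I)))

/-- **The `k₀` ceilings are at most `3`**: `⌈rdN I (bOf I) / rdK I (bOf I)⌉ = (rdN + rdK − 1)/rdK ≤ 3` whenever `11 ≤ s_I` (`rdN ≤ D/800 ≤ 3·(11D/(13·1600)) ≤ 3·rdK`) — so
hp-8's `k₀F = max_I ⌈…⌉ ≤ 3`. [folklore] -/
theorem k₀_ceil_le_three (κ : Consts) {V : Type} [DecidableEq V] [Countable V] {G : SimpleGraph V} [G.LocallyFinite] (Φ : PlanarSkeletonFrm G) (t : V) (p : unitInterval) (D : Skelφ.StepI.DataNS V) (g : ℕ) (f : ℕ) (hN : EqNumL κ Φ t p D g f) (I : Fin 2) (hs : 11 ≤ (fcells κ Φ t p D g f).s I) :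
    ((prF κ Φ t p D g f).rdN I ((prF κ Φ t p D g f).bOf I) + (prF κ Φ t p D g f).rdK I ((prF κ Φ t p D g f).bOf I) - 1) /
        (prF κ Φ t p D g f).rdK I ((prF κ Φ t p D g f).bOf I) ≤ 3 := by
  have h1 := cL_lower κ Φ t p D g f hN I hs
  have h2 := rdK_lower κ Φ t p D g f I
  have h3 := rdN_upper κ Φ t p D g f hN I ((prF κ Φ t p D g f).bOf I)
  have hpos := rdK_pos_R κ Φ t p D g f hN I
  have h4 : (prF κ Φ t p D g f).rdN I ((prF κ Φ t p D g f).bOf I) ≤ 3 * (prF κ Φ t p D g f).rdK I ((prF κ Φ t p D g f).bOf I) := by nlinarith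
  have h5 : (prF κ Φ t p D g f).rdN I ((prF κ Φ t p D g f).bOf I) + (prF κ Φ t p D g f).rdK I ((prF κ Φ t p D g f).bOf I) - 1 < 4 * (prF κ Φ t p D g f).rdK I ((prF κ Φ t p D g f).bOf I) := by linarith
  have := Int.ediv_lt_of_lt_mul hpos h5
  omega

/-- `3·rdK ≥ rdN` in the product form hp-8's `hk₀` consumes (`rdN I (bOf I) ≤ rdK I (bOf I) * 3`). [folklore] -/
theorem rdN_le_three_rdK (κ : Consts) {V : Type} [DecidableEq V] [Countable V] {G : SimpleGraph V} [G.LocallyFinite] (Φ : PlanarSkeletonFrm G) (t : V) (p : unitInterval) (D : Skelφ.StepI.DataNS V) (g : ℕ) (f : ℕ) (hN : EqNumL κ Φ t p D g f) (I : Fin 2) (hs : 11 ≤ (fcells κ Φ t p D g f).s I) :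
    (prF κ Φ t p D g f).rdN I ((prF κ Φ t p D g f).bOf I) ≤ (prF κ Φ t p D g f).rdK I ((prF κ Φ t p D g f).bOf I) * 3 := by
  have h1 := cL_lower κ Φ t p D g f hN I hs
  have h2 := rdK_lower κ Φ t p D g f I
  have h3 := rdN_upper κ Φ t p D g f hN I ((prF κ Φ t p D g f).bOf I)
  have hpos := rdK_pos_R κ Φ t p D g f hN I
  nlinarith

/-- `11 ≤ s_i` at `g := KS.gT` (from `cells_geT`: `6·RA' + 11 ≤ s₀`, `14·RA' + 27 ≤ s₁`). [folklore] -/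
theorem eleven_le_s_T (κ : Consts) {V : Type} [DecidableEq V] [Countable V] {G : SimpleGraph V} [G.LocallyFinite] (Φ : PlanarSkeletonFrm G) (t : V) (p : unitInterval) (D : Skelφ.StepI.DataNS V) (f : ℕ) (mk : ℕ) (gx : Neg.FSlot) (hN : EqNumL κ Φ t p D (KS.gT mk gx κ Φ t p D) f) (hκ : (hL κ Φ t p D (KS.gT mk gx κ Φ t p D) f).natAbs ≤ 10 * nL κ Φ t p D (KS.gT mk gx κ Φ t p D) f)
    (i : Fin 2) : 11 ≤ (fcells κ Φ t p D (KS.gT mk gx κ Φ t p D) f).s i := by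
  obtain ⟨hs0, hs1⟩ := KS.cells_geT κ Φ t p D mk gx f hN hκ
  obtain rfl | rfl : i = 0 ∨ i = 1 := by fin_cases i <;> simp
  · have : (11 : ℤ) ≤ (((fcells κ Φ t p D (KS.gT mk gx κ Φ t p D) f).s 0 : ℕ) : ℤ) := by linarith
    exact_mod_cast this
  · have : (11 : ℤ) ≤ (((fcells κ Φ t p D (KS.gT mk gx κ Φ t p D) f).s 1 : ℕ) : ℤ) := by linarith
    exact_mod_cast this

/-- **`hk₀'` AT THE VALUES** for any `k₀ ≤ 3` (`g := KS.gT`, any `f`): `∀ i, 3·r i + k₀ + 3 ≤ 5·r i` (`r_i = K·s_i ≥ 40·11`). [folklore] -/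
theorem hk₀'_R (κ : Consts) {V : Type} [DecidableEq V] [Countable V] {G : SimpleGraph V} [G.LocallyFinite] (Φ : PlanarSkeletonFrm G) (t : V) (p : unitInterval) (D : Skelφ.StepI.DataNS V) (f : ℕ) (mk : ℕ) (gx : Neg.FSlot) (hN : EqNumL κ Φ t p D (KS.gT mk gx κ Φ t p D) f) (hκ : (hL κ Φ t p D (KS.gT mk gx κ Φ t p D) f).natAbs ≤ 10 * nL κ Φ t p D (KS.gT mk gx κ Φ t p D) f)
    {k₀ : ℤ} (hk : k₀ ≤ 3) (i : Fin 2) :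
    3 * ((fcells κ Φ t p D (KS.gT mk gx κ Φ t p D) f).r i : ℤ) + k₀ + 3 ≤ 5 * ((fcells κ Φ t p D (KS.gT mk gx κ Φ t p D) f).r i : ℤ) := by
  have hs := eleven_le_s_T κ Φ t p D f mk gx hN hκ i
  have hr := (fcells_K κ Φ t p D (KS.gT mk gx κ Φ t p D) f).2.2 i
  have hK := (Neg.forty_le_K κ).1
  have : 440 ≤ (fcells κ Φ t p D (KS.gT mk gx κ Φ t p D) f).r i := by rw [hr]; nlinarith
  have : (440 : ℤ) ≤ ((fcells κ Φ t p D (KS.gT mk gx κ Φ t p D) f).r i : ℤ) := by exact_mod_cast this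
  linarith

end Lat

end NegB

end PlanarSkeletonFrm

end Summit.CriticalPhenomena.PercolationContinuityZ3.Theorems.Transplant

end
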